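import Summits.QuantumFields.YangMills.Theses.CheckerboardTriality
import HarnessLib

/-!
# LINE g10-A «sigma3-twin» — the three S-sized stubs of the registered skeleton of `Sigma3DenseUpgrade`

Support item `Summit.QuantumFields.YangMills.Theses.CheckerboardTriality.Sigma3DenseUpgrade` (stmt-QuantumFields-23399) of
route-QuantumFields-CheckerboardTriality (rev 2) carries a registered five-stub skeleton (`Sigma3Dense.Sigma3DenseUpgrade_of`,
planner ym-idea-1 g10).  This file proves the three small stubs BY NAME AND SIGNATURE:

* `stub_exists` — the Σ3 twin rotation `g₃ = 1 ⊕ (1/3)[[1,2,2],[2,1,−2],[−2,2,−1]]` is a linear isometry of `ℝ⁴`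
  (explicit linear equivalence with inverse `g₃ᵀ`, norm identity by `ring`);
* `stub_irrational` — `arccos(−1/3)/(2π) ∉ ℚ` (Mathlib's Niven theorem `niven`: `cos = −1/3 ∉ {0, ±1/2, ±1}`);
* `stub_closure` — invariance of a family on King's class `KingClass n r₀` under a set of isometries passes to the subgroup it
  generates (`Subgroup.closure_induction`, the action laws `linActMulti_trans_eq` / `linActMulti_refl_eq`, `King.linActMulti_mem_kingClass`).

The two M-sized stubs (`stub_conjCircle`, `stub_generation`) remain open.  No definition of the route is touched, no named
fact, no sorry; standard axioms.  Nothing here proves a crux, a leg, a rung or the summit.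
-/

set_option autoImplicit false

noncomputable section

open scoped SchwartzMap Real
open MeasureTheory Filter Topology
open Literature.MathematicalPhysics.QuantumFieldTheory Literature.MathematicalPhysics.QuantumLattice
open Literature.MathematicalPhysics.AQFT Literature.Probability.LatticeModels
open Summit.QuantumFields.YangMills.Cruxes.OSLegsFromFemtoAndGap.DlrCollarTransfer
open Summit.QuantumFields.YangMills.Cruxes.OSLegsAtWeakCouplingC.Sketch
open Summit.QuantumFields.YangMills.Cruxes.OSLegsAtWeakCouplingC.Y2Bridge
open Summit.QuantumFields.YangMills.Theorems.ROT
open Summit.QuantumFields.YangMills.Theorems.OSLegsFromFemtoAndGap.Upgrade (linActMulti_trans_eq linActMulti_refl_eq)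

namespace Summit.QuantumFields.YangMills.Cruxes.SexticClosure.Sigma3Dense

/-! ## The Σ3 twin rotation as a linear isometry -/

/-- The coordinates of `g₃ x`. -/
def sigma3Fun (x : EuclideanSpace ℝ (Fin 4)) : Fin 4 → ℝ :=
  ![x 0, (x 1 + 2 * x 2 + 2 * x 3) / 3, (2 * x 1 + x 2 - 2 * x 3) / 3, (-2 * x 1 + 2 * x 2 - x 3) / 3]

/-- The coordinates of `g₃ᵀ x = g₃⁻¹ x`. -/
def sigma3InvFun (x : EuclideanSpace ℝ (Fin 4)) : Fin 4 → ℝ :=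
  ![x 0, (x 1 + 2 * x 2 - 2 * x 3) / 3, (2 * x 1 + x 2 + 2 * x 3) / 3, (2 * x 1 - 2 * x 2 - x 3) / 3]

/-- `g₃` as a linear map. [folklore] -/
def sigma3Lin : EuclideanSpace ℝ (Fin 4) →ₗ[ℝ] EuclideanSpace ℝ (Fin 4) where
  toFun x := WithLp.toLp 2 (sigma3Fun x)
  map_add' x y := by
    ext j
    fin_cases j <;> simp [sigma3Fun] <;> ring
  map_smul' c x := by
    ext j
    fin_cases j <;> simp [sigma3Fun] <;> ring

/-- `g₃ᵀ` as a linear map. [folklore] -/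
def sigma3InvLin : EuclideanSpace ℝ (Fin 4) →ₗ[ℝ] EuclideanSpace ℝ (Fin 4) where
  toFun x := WithLp.toLp 2 (sigma3InvFun x)
  map_add' x y := by
    ext j
    fin_cases j <;> simp [sigma3InvFun] <;> ring
  map_smul' c x := by
    ext j
    fin_cases j <;> simp [sigma3InvFun] <;> ring

/-- Coordinates of `sigma3Lin`. [folklore] -/
@[simp] theorem sigma3Lin_apply (x : EuclideanSpace ℝ (Fin 4)) (j : Fin 4) :
    sigma3Lin x j = sigma3Fun x j := rfl

/-- Coordinates of `sigma3InvLin`. [folklore] -/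
@[simp] theorem sigma3InvLin_apply (x : EuclideanSpace ℝ (Fin 4)) (j : Fin 4) :
    sigma3InvLin x j = sigma3InvFun x j := rfl

/-- `g₃ᵀ g₃ = 1`. [folklore] -/
theorem sigma3InvLin_sigma3Lin (x : EuclideanSpace ℝ (Fin 4)) : sigma3InvLin (sigma3Lin x) = x := by
  ext j
  fin_cases j <;> simp [sigma3Fun, sigma3InvFun] <;> ring

/-- `g₃ g₃ᵀ = 1`. [folklore] -/
theorem sigma3Lin_sigma3InvLin (x : EuclideanSpace ℝ (Fin 4)) : sigma3Lin (sigma3InvLin x) = x := by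
  ext j
  fin_cases j <;> simp [sigma3Fun, sigma3InvFun] <;> ring

/-- `g₃` as a linear equivalence (inverse `g₃ᵀ`). [folklore] -/
def sigma3Equiv : EuclideanSpace ℝ (Fin 4) ≃ₗ[ℝ] EuclideanSpace ℝ (Fin 4) :=
  { sigma3Lin with
    invFun := sigma3InvLin
    left_inv := sigma3InvLin_sigma3Lin
    right_inv := sigma3Lin_sigma3InvLin }

/-- `g₃` preserves the Euclidean norm (its rows are orthonormal). [folklore] -/
theorem norm_sigma3Lin (x : EuclideanSpace ℝ (Fin 4)) : ‖sigma3Lin x‖ = ‖x‖ := by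
  rw [EuclideanSpace.norm_eq, EuclideanSpace.norm_eq]
  congr 1
  simp only [Fin.sum_univ_four, Real.norm_eq_abs, sq_abs, sigma3Lin_apply, sigma3Fun]
  simp
  ring

/-- **The Σ3 twin rotation** `g₃ = 1 ⊕ (1/3)[[1,2,2],[2,1,−2],[−2,2,−1]] ∈ SO(4,ℚ)` as a linear isometry of `ℝ⁴`
(angle `arccos(−1/3)` about the spatial axis `e₁ + e₂`; `ℤ⁴ ∩ g₃ℤ⁴` has index 3). [folklore] -/
def sigma3 : EuclideanSpace ℝ (Fin 4) ≃ₗᵢ[ℝ] EuclideanSpace ℝ (Fin 4) :=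
  LinearIsometryEquiv.mk sigma3Equiv fun x => by
    show ‖sigma3Lin x‖ = ‖x‖
    exact norm_sigma3Lin x

/-- Coordinates of `sigma3`. [folklore] -/
@[simp] theorem sigma3_apply (x : EuclideanSpace ℝ (Fin 4)) (j : Fin 4) : sigma3 x j = sigma3Fun x j := rfl

/-- Registered stub `stub_exists` (S) of the skeleton of `Sigma3DenseUpgrade`: the Σ3 rotation exists as a linear isometry with
the pinned rational coordinates. [folklore] -/
theorem stub_exists : ∃ R : EuclideanSpace ℝ (Fin 4) ≃ₗᵢ[ℝ] EuclideanSpace ℝ (Fin 4),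
    (∀ x : EuclideanSpace ℝ (Fin 4), R x 0 = x 0 ∧ R x 1 = (x 1 + 2 * x 2 + 2 * x 3) / 3 ∧
      R x 2 = (2 * x 1 + x 2 - 2 * x 3) / 3 ∧ R x 3 = (-2 * x 1 + 2 * x 2 - x 3) / 3) := by
  refine ⟨sigma3, fun x => ⟨?_, ?_, ?_, ?_⟩⟩ <;> simp [sigma3Fun]

/-! ## The Σ3 angle is an irrational multiple of `2π` -/

/-- `cos (arccos (−1/3)) = −1/3`. [folklore] -/
theorem cos_arccos_neg_third : Real.cos (Real.arccos (-1 / 3)) = -1 / 3 := by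
  rw [Real.cos_arccos] <;> norm_num

/-- Registered stub `stub_irrational` (S): `arccos(−1/3)/(2π) ∉ ℚ` — Niven's theorem (a rational multiple of `π` with rational
cosine has cosine in `{0, ±1/2, ±1}`; here the cosine is `−1/3`). [standard: Niven 1956, Cor. 3.12] -/
theorem stub_irrational : Irrational (Real.arccos (-1 / 3) / (2 * π)) := by
  rintro ⟨q, hq⟩
  have hθ : ∃ r : ℚ, Real.arccos (-1 / 3) = r * π := by
    refine ⟨2 * q, ?_⟩
    have hπ : (π : ℝ) ≠ 0 := Real.pi_ne_zero
    push_cast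
    rw [hq]
    field_simp
  have hcos : ∃ q' : ℚ, Real.cos (Real.arccos (-1 / 3)) = q' :=
    ⟨-1 / 3, by rw [cos_arccos_neg_third]; push_cast; ring⟩
  have h := niven hθ hcos
  rw [cos_arccos_neg_third] at h
  simp only [Set.mem_insert_iff, Set.mem_singleton_iff] at h
  norm_num at h

/-! ## Invariance passes to the generated subgroup -/

/-- The group law of `E4 ≃ₗᵢ[ℝ] E4` acts through `linActMulti`: `F_{g h} = (F_h)_g`. [folklore] -/
theorem linActMulti_mul_eq {n : ℕ} (g h : EuclideanSpace ℝ (Fin 4) ≃ₗᵢ[ℝ] EuclideanSpace ℝ (Fin 4))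
    (F : 𝓢((Fin n → EuclideanSpace ℝ (Fin 4)), ℂ)) :
    linActMulti (g * h) F = linActMulti g (linActMulti h F) := by
  rw [LinearIsometryEquiv.mul_def, linActMulti_trans_eq]

/-- The unit acts trivially. [folklore] -/
theorem linActMulti_one_eq {n : ℕ} (F : 𝓢((Fin n → EuclideanSpace ℝ (Fin 4)), ℂ)) :
    linActMulti (1 : EuclideanSpace ℝ (Fin 4) ≃ₗᵢ[ℝ] EuclideanSpace ℝ (Fin 4)) F = F := by
  rw [LinearIsometryEquiv.one_def, linActMulti_refl_eq]

/-- Registered stub `stub_closure` (S): invariance of `S₁ n` on `KingClass n r₀` under every element of a set `𝒢` of isometries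
gives invariance under every element of the subgroup generated by `𝒢` (King's class is stable under isometries). [folklore] -/
theorem stub_closure : ∀ (S₁ : SchwingerFamily (EuclideanSpace ℝ (Fin 4))) (n : ℕ) (r₀ : ℝ)
    (𝒢 : Set (EuclideanSpace ℝ (Fin 4) ≃ₗᵢ[ℝ] EuclideanSpace ℝ (Fin 4))),
    (∀ g ∈ 𝒢, ∀ F ∈ King.KingClass n r₀, S₁ n (linActMulti g F) = S₁ n F) →
    ∀ g ∈ Subgroup.closure 𝒢, ∀ F ∈ King.KingClass n r₀, S₁ n (linActMulti g F) = S₁ n F := by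
  intro S₁ n r₀ 𝒢 h𝒢 g hg
  induction hg using Subgroup.closure_induction with
  | mem x hx => exact h𝒢 x hx
  | one => intro F hF; rw [linActMulti_one_eq]
  | mul x y hx hy ihx ihy =>
      intro F hF
      rw [linActMulti_mul_eq, ihx _ (King.linActMulti_mem_kingClass hF y), ihy F hF]
  | inv x hx ihx =>
      intro F hF
      have h1 := ihx _ (King.linActMulti_mem_kingClass hF x⁻¹)
      rw [← linActMulti_mul_eq, mul_inv_cancel, linActMulti_one_eq] at h1
      exact h1.symm

end Summit.QuantumFields.YangMills.Cruxes.SexticClosure.Sigma3Dense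

end
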